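import Summits.QuantumFields.BalabanUV.Beta.NVertexLamSectorStoreyKernels
import Summits.QuantumFields.BalabanUV.Beta.NVertexSectorsPeriodised

/-!
# `BalabanUV.Beta.NVertexLamCorePeriodised` — row D1 ∕ (C1), PART 16: **THE STOREY CORES OF THE Λ SECTOR, PERIODISED — the diagonal periodisation of a
# weighted brick core on the storey torus IS the same core with the weight PERIODISED over the slot torus one level up; at the record the weight is the
# transported multiplier response `λ′ᴿ_k`, so `dper Tc 𝒢ᴿ_k = −cΛ · Σ_κ Σ'_s (Σ'_m λ′ᴿ_k (κ, s + Tc′∘m)) · 𝒽 κ s|ff = −cΛ · Σ_κ Σ_{r ∈ pbox Tc′} (Σ'_m λ′ᴿ_k (κ, r + Tc′∘m)) ·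
# dper Tc (𝒽 κ r|ff)`** (the junction currency of SPEC-49 §B's weight word `w n k · hb n B k v ā = cΛ · Σ_m λ′_k (ā + T_k∘m)`, row side)

WHY (located).  PART 15 (`NVertexLamSectorStoreyKernels`) displays `cΛ · ℒN|ff` as `Σ_k 𝒦ᴿ_k`, each `𝒦ᴿ_k` the `compLinKer ℓ Lc k`-sandwich of the lattice core
`𝒢ᴿ_k γ γ' a a' = −cΛ · Σ_κ Σ'_s λ′ᴿ_k (κ,s) · symHessKerAt (toSite R.r) Lc κ s (a,γ) (a',γ')` — the road's `h𝒦` display (g38 `FP/TorusLamJunctionShape`, p469378 ✓) with the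
row's core.  The road's (E4b) identity `hΛN` is stated AFTER the diagonal periodisation `dper T` on the finest torus, and the road's engine periodises a sandwich
through its core (`TorusTwoScaleSandwichLetters.dper_sandwich_apply`: `dper Tf 𝒦 = legs · dper Tc 𝒢 · legs`, core letter `hGd`), so what (J-Λ-lat) compares per
storey is `dper Tc (road core)` against `dper Tc 𝒢ᴿ_k` on the STOREY torus `Tc` (`Tc = Lc · Tc′`, `Tc′` the slot torus one level up).  THIS FILE computes the
row's side: §1 for ANY window-supported, block-covariant brick family `𝓋` and any weight `D` summable in the slot site (generic `d`, any tori `Tc i = L · Tc′ i`)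
— the brick's covariance moves a diagonal `Tc`-translate of the core onto a `Tc′`-translate of the weight's slot (`weightedCore_translate`), the core's
diagonal letter holds (`summable_weightedCore_diag` — the `hGd` the road's sandwich letters ask of a core), and
**`dper_weightedCore_apply : dper Tc 𝒢[D] γ γ' a a' = c · Σ_κ Σ'_s (Σ'_m D κ (s + Tc′∘m)) · 𝓋 k κ s (a,γ) (a',γ')`** (the slot `tsum` is finitely supported
in the near-box of `γ`; the weight's period sum converges absolutely); §2 the periodised weight is `Tc′`-periodic (`periodisedWeight_translate`) and the slot sum
folds onto REPRESENTATIVES: **`dper_weightedCore_apply_reps : dper Tc 𝒢[D] γ γ' a a' = c · Σ_κ Σ_{r ∈ pbox Tc′} (Σ'_m D κ (r + Tc′∘m)) · dper Tc (𝓋 k κ r)♭ γ γ' a a'`**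
(`(𝓋 k κ r)♭ x x' b b' := 𝓋 k κ r (b,x) (b',x')`; `KernelPeriodisationFibTrace.tsum_sites_eq_sum_tsum` + the brick's covariance once more) — «periodised weight
times periodised brick, summed over the slot torus»; §3 at the record (`𝓋 _ := symHessKerAt (toSite R.r) Lc`: support `symHessKerAt_eq_zero_left R.hr`,
covariance `symHessKerAt_add`; `D := λ′ᴿ_k`, summable by PART 15 `summable_lamR`): **`dper_lamCoreR_apply`**, **`dper_lamCoreR_apply_reps`**,
`summable_lamCoreR_diag`, and at the wrapper's tower (`Tc := towerTorus Lc (fine Lc M) m`, `Tc′ := towerTorus Lc M m`, `towerTorus_apply`) `dper_lamCoreR_apply_tower`.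
READING: with SPEC-49 §B's W-4 (3) presentation (`cf k μ y κ u := [κ = μ ∧ u = Lc•y]`, `hb k (x,κ) := [Lc ∣ x]·Λ′ k (κ, x∕Lc)`) the road's periodised core at co-depth
`j' = n+1−k` is `−w j' · Σ_{(Lc•r, κ)} hb j' (Lc•r, κ) · dper Tc (𝒽 κ r|ff)`, so `hΛN` holds storey by storey as soon as `w j' · hb j' (Lc•r, κ) = cΛ · Σ'_m λ′ᴿ_k (κ, r + Tc′∘m)`
on `r ∈ pbox Tc′` (up to the road's per-step leg scalars) — the weight word with `λ′_k := λ′ᴿ_k`; that scalar junction is the ROAD's instantiation (not here).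
§4 (`dper_lamN_eq_dper_LN`): the road's `ΛN` (torus-column-weighted box sum) and the row's lattice `ℒN μ y|ff` have the SAME diagonal periodisation.
WHAT ([folklore] `tsum` bookkeeping BY NAME; no `def`, no `def … : Prop`, nothing cited, 0 sorry): §1 `slot_mem_nearBox_of_near`, `bond_translate_eq_sh`, `weightedCore_translate(_eq_sum)`,
`summable_weightedCore_diag`, **`dper_weightedCore_apply`**; §2 `periodisedWeight_translate`, `tsum_brick_translate_eq_dper`, **`dper_weightedCore_apply_reps`**;
§3 `lamR_top` (top storey: `λ′ᴿ_j = Λ′_N`, (K1) currency), `summable_lamCoreR_diag`, **`dper_lamCoreR_apply(_reps ∕ _tower)`**; §4 **`dper_lamN_eq_dper_LN`**.  WHAT THIS IS NOT: not (J-Λ-lat) itself (the road's core, its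
`w ∕ hb ∕ cf` instantiation, the leg scalars and the finest-torus assembly through `dper_sandwich_apply` are the road's); not (K1) for the nested column; not (J-W)∕(J-X)
(road FP g39 Q-FP-39-1 ∕ R-FP-79 — the Λ half is slice-blind, nothing here consumes R-FP-77 (ii)); no row of the END wrapper discharged; 0 estimates; nothing of Bałaban's
asserted, valued or discharged; 0∕4 row-D1 binders (hW, hR, D1Tel, D1Rep); NOT (C1), NOT (L2′), NOT D1, NEVER «G-an2-4 closed», NOT BetaPertH, NOT continuum, NOT Clay.

HONEST DEPENDENCY (page 1, mandatory): continuum YM on T⁴ ⇐ BetaPertH ∧ nine spine estimates (0/9 proved); BetaPertH ⇐ (D1) ∧ (D4) ∧ CAP+tail;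
G-an2-4 gates asym, D1 and NE2/3/4.  HONEST FRAMING (cell contract, verbatim): «discharging `BetaPertH` makes Bałaban's UV stability UNCONDITIONAL —
a real constructive-QFT result; it is NOT the continuum limit and NOT the Clay problem.»  ABSOLUTE RULE (cell charter, verbatim): «No internally-minted
statement may enter as a cited fact. Every hypothesis is either kernel-proved in this package or a verbatim quotation of a PUBLISHED theorem with page
reference. The manuscript(s) under audit are NOT citable for their own disputed steps — they are the thing under adjudication; programme-internal
(2001/route/tribunal) claims are never citable.»  Row D1 ∕ (C1) OWNER an2 (b2b-balaban-beta-an2) gen 62, 2026-08-27.  No existing file touched.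
-/

noncomputable section

open scoped BigOperators

namespace Summit.QuantumFields.BalabanUV.Beta.NVertexLamCorePeriodised

open Finset
open Literature.MathematicalPhysics.QuantumFieldTheory
open Literature.MathematicalPhysics.QuantumFieldTheory.Balaban1983to89
open Literature.MathematicalPhysics.QuantumFieldTheory.Balaban1983to89.Beta
open B4TorusKernel.MultiPeriod (translate translate_injective)
open B4Reflection242 (translate_translate)
open B5Prop11Plancherel (fine)
open B6Lemma24Torus (pbox)
open AffineAveraging (Site box toSite)
open AveragingHessianKernels (Bond Near ell)
open ExpKernelCalculus (MKer)
open OneStepResolventKernel (Fib KInv)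
open BalabanStepJets (lamCoeffOf)
open Summit.QuantumFields.BalabanUV.Beta.AxialDressingRooted (one_le_of_neZero)
open Summit.QuantumFields.BalabanUV.Beta.SymAveragingHessianCounts (symLinKerAt symHessKerAt symHessKerAt_eq_zero_left symHessKerAt_add)
open Summit.QuantumFields.BalabanUV.Beta.CompositeVertexKernelRec (compLinKer winF compLinKer_zero)
open Summit.QuantumFields.BalabanUV.Beta.CompositeVertexKernelLiftKernel (mem_piFinset_of_mem_winF)
open Summit.QuantumFields.BalabanUV.Beta.CompositeOneShotJetData (Roots Pins AN)
open Summit.QuantumFields.BalabanUV.Beta.FP.KernelPeriodisationFib (translate_eq_add)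
open Summit.QuantumFields.BalabanUV.Beta.FP.KernelPeriodisationFibLoc (dper dper_apply)
open Summit.QuantumFields.BalabanUV.Beta.FP.KernelPeriodisationFibTrace (tsum_sites_eq_sum_tsum)
open Summit.QuantumFields.BalabanUV.Beta.FP.TorusCompositeObjects (towerTorus towerTorus_apply)
open OneStepKernelFamily (vertexOfK)
open InterLevelTransport (SLam)
open Summit.QuantumFields.BalabanUV.Beta.CompositeOneShotJets (compH)
open Summit.QuantumFields.BalabanUV.Beta.FP.KernelPeriodisationFib (perF)
open Summit.QuantumFields.BalabanUV.Beta.FP.KernelPeriodisationFibLoc (summable_dper)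
open Summit.QuantumFields.BalabanUV.Beta.FP.TorusGaugeCovariancePairing (wrapPt)
open Summit.QuantumFields.BalabanUV.Beta.CombHId1Letters (dper_vertexOfK_eq_sum perZ_coarse_col_eq_perF)
open Summit.QuantumFields.BalabanUV.Beta.NVertexSectors (decays_AN)
open Summit.QuantumFields.BalabanUV.Beta.NVertexSectorsPeriodised (AN_translate_invariant periodCov_of_St lamSector_St locStencil_lamSector)
open Summit.QuantumFields.BalabanUV.Beta.NVertexLamSectorStoreyKernels (summable_lamR)

variable {d : ℕ}

/-! ## §1 Generic: the diagonal periodisation of a weighted brick core = the core with periodised weight -/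

section Generic

variable {𝓋 : ℕ → Fin (d + 1) → Site (d + 1) → Bond (d + 1) → Bond (d + 1) → ℝ} {L : ℕ}
  (Tc Tc' : Fin (d + 1) → ℕ)

/-- [folklore] **the NEAR-BOX of a site**: if `γ` is in the one-step window of the slot `s` (an1's `Near L s γ`), then `s` lies in the explicit finite box
`Π_i Icc ((γ_i − (2L−1)) ∕ L) (γ_i ∕ L)` (F6a″'s `mem_piFinset_of_mem_winF` at `winF L (2L−1)`; `0 < L`). -/
theorem slot_mem_nearBox_of_near (hL : 0 < L) {s γ : Site (d + 1)} (h : Near L s γ) :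
    s ∈ Fintype.piFinset fun i => Finset.Icc ((γ i - ((2 * L - 1 : ℕ) : ℤ)) / (L : ℤ)) (γ i / (L : ℤ)) := by
  refine mem_piFinset_of_mem_winF (N := L) (W := 2 * L - 1) hL (y := s) (z := γ) ?_
  rw [Summit.QuantumFields.BalabanUV.Beta.CompositeVertexKernelRec.mem_winF_iff]
  intro i
  obtain ⟨h1, h2⟩ := h i
  have hc : ((2 * L - 1 : ℕ) : ℤ) = 2 * (L : ℤ) - 1 := by omega
  exact ⟨h1, by rw [hc]; exact h2⟩

/-- [folklore] with `Tc i = L · Tc′ i`, a `Tc`-translated bond is the bond shifted by `L • (Tc′∘m)`: `(a, γ + Tc∘m) = (a, γ).sh (L • (Tc′∘m))`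
(road FP's `PeriodisedBorderTables.translate_eq_add_smul`). -/
theorem bond_translate_eq_sh (hT : ∀ i, Tc i = L * Tc' i) (a : Fin (d + 1)) (γ m : Site (d + 1)) :
    ((a, translate Tc γ m) : Bond (d + 1)) = Bond.sh (a, γ) ((L : ℤ) • fun i => (Tc' i : ℤ) * m i) := by
  unfold Bond.sh
  exact Prod.ext rfl (FP.PeriodisedBorderTables.translate_eq_add_smul hT γ m)

variable (h𝓋l : ∀ i μ y g g', ¬ Near L y g.2 → 𝓋 i μ y g g' = 0)
  (h𝓋sh : ∀ i μ y t g g', 𝓋 i μ (y + t) (g.sh ((L : ℤ) • t)) (g'.sh ((L : ℤ) • t)) = 𝓋 i μ y g g')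
include h𝓋sh

/-- [folklore] **`weightedCore_translate` — A DIAGONAL `Tc`-TRANSLATE OF THE WEIGHTED CORE IS A `Tc′`-TRANSLATE OF THE WEIGHT's SLOT** (brick covariance, the slot
sum re-indexed by `s ↦ s + Tc′∘m`): `𝒢[D] (γ + Tc∘m) (γ' + Tc∘m) a a' = c · Σ_κ Σ'_s D κ (s + Tc′∘m) · 𝓋 k κ s (a,γ) (a',γ')`. -/
theorem weightedCore_translate (hT : ∀ i, Tc i = L * Tc' i) (c : ℝ) (D : Fin (d + 1) → Site (d + 1) → ℝ) (k : ℕ) (m γ γ' : Site (d + 1))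
    (a a' : Fin (d + 1)) :
    (c * ∑ κ : Fin (d + 1), ∑' s : Site (d + 1), D κ s * 𝓋 k κ s (a, translate Tc γ m) (a', translate Tc γ' m))
      = c * ∑ κ : Fin (d + 1), ∑' s : Site (d + 1), D κ (translate Tc' s m) * 𝓋 k κ s (a, γ) (a', γ') := by
  congr 1
  refine Finset.sum_congr rfl fun κ _ => ?_
  set t : Site (d + 1) := fun i => (Tc' i : ℤ) * m i with ht
  rw [← (Equiv.addRight t).tsum_eq fun s => D κ s * 𝓋 k κ s (a, translate Tc γ m) (a', translate Tc γ' m)]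
  refine tsum_congr fun s => ?_
  rw [Equiv.coe_addRight, bond_translate_eq_sh Tc Tc' hT a γ m, bond_translate_eq_sh Tc Tc' hT a' γ' m, ← ht, h𝓋sh k κ s t (a, γ) (a', γ'),
    translate_eq_add Tc' s m]

include h𝓋l

/-- [folklore] the same with the slot sum CUT DOWN to the near-box of `γ` (the brick vanishes off the window of its slot). -/
theorem weightedCore_translate_eq_sum (hL : 0 < L) (hT : ∀ i, Tc i = L * Tc' i) (c : ℝ) (D : Fin (d + 1) → Site (d + 1) → ℝ) (k : ℕ)
    (m γ γ' : Site (d + 1)) (a a' : Fin (d + 1)) :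
    (c * ∑ κ : Fin (d + 1), ∑' s : Site (d + 1), D κ s * 𝓋 k κ s (a, translate Tc γ m) (a', translate Tc γ' m))
      = c * ∑ κ : Fin (d + 1), ∑ s ∈ Fintype.piFinset (fun i => Finset.Icc ((γ i - ((2 * L - 1 : ℕ) : ℤ)) / (L : ℤ)) (γ i / (L : ℤ))),
          D κ (translate Tc' s m) * 𝓋 k κ s (a, γ) (a', γ') := by
  rw [weightedCore_translate Tc Tc' h𝓋sh hT c D k m γ γ' a a']
  congr 1
  refine Finset.sum_congr rfl fun κ _ => ?_
  exact tsum_eq_sum fun s hs => by rw [h𝓋l k κ s (a, γ) (a', γ') (fun h => hs (slot_mem_nearBox_of_near hL h)), mul_zero]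

/-- [folklore] **`summable_weightedCore_diag` — THE CORE's DIAGONAL LETTER** (the `hGd` the road's sandwich letters ask of a core): for a weight summable in the
slot site and `1 ≤ Tc′ i`, `m ↦ 𝒢[D] (γ + Tc∘m) (γ' + Tc∘m) a a'` is summable (finitely many slots near `γ`, each weight translate-summable by injectivity). -/
theorem summable_weightedCore_diag (hL : 0 < L) (hT : ∀ i, Tc i = L * Tc' i) (hTc' : ∀ i, 1 ≤ Tc' i) (c : ℝ) {D : Fin (d + 1) → Site (d + 1) → ℝ}
    (hD : ∀ κ, Summable (D κ)) (k : ℕ) (γ γ' : Site (d + 1)) (a a' : Fin (d + 1)) :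
    Summable fun m : Site (d + 1) =>
      c * ∑ κ : Fin (d + 1), ∑' s : Site (d + 1), D κ s * 𝓋 k κ s (a, translate Tc γ m) (a', translate Tc γ' m) := by
  have h : Summable fun m : Site (d + 1) =>
      c * ∑ κ : Fin (d + 1), ∑ s ∈ Fintype.piFinset (fun i => Finset.Icc ((γ i - ((2 * L - 1 : ℕ) : ℤ)) / (L : ℤ)) (γ i / (L : ℤ))),
        D κ (translate Tc' s m) * 𝓋 k κ s (a, γ) (a', γ') :=
    (summable_sum fun κ _ => summable_sum fun s _ =>
      ((hD κ).comp_injective (translate_injective hTc' s)).mul_right (𝓋 k κ s (a, γ) (a', γ'))).mul_left c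
  exact h.congr fun m => (weightedCore_translate_eq_sum Tc Tc' h𝓋l h𝓋sh hL hT c D k m γ γ' a a').symm

/-- [folklore] **`dper_weightedCore_apply` — THE DIAGONAL PERIODISATION OF A WEIGHTED BRICK CORE IS THE CORE WITH PERIODISED WEIGHT**: for a window-supported,
block-covariant brick family `𝓋`, a weight `D` summable in the slot site, tori `Tc i = L · Tc′ i` with `1 ≤ Tc′ i` and `0 < L`,
`dper Tc (fun x x' a a' => c · Σ_κ Σ'_s D κ s · 𝓋 k κ s (a,x) (a',x')) γ γ' a a' = c · Σ_κ Σ'_s (Σ'_m D κ (s + Tc′∘m)) · 𝓋 k κ s (a,γ) (a',γ')`. -/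
theorem dper_weightedCore_apply (hL : 0 < L) (hT : ∀ i, Tc i = L * Tc' i) (hTc' : ∀ i, 1 ≤ Tc' i) (c : ℝ) {D : Fin (d + 1) → Site (d + 1) → ℝ}
    (hD : ∀ κ, Summable (D κ)) (k : ℕ) (γ γ' : Site (d + 1)) (a a' : Fin (d + 1)) :
    dper Tc (fun x x' (b b' : Fin (d + 1)) => c * ∑ κ : Fin (d + 1), ∑' s : Site (d + 1), D κ s * 𝓋 k κ s (b, x) (b', x')) γ γ' a a'
      = c * ∑ κ : Fin (d + 1), ∑' s : Site (d + 1), (∑' m : Site (d + 1), D κ (translate Tc' s m)) * 𝓋 k κ s (a, γ) (a', γ') := by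
  set NB := Fintype.piFinset (fun i => Finset.Icc ((γ i - ((2 * L - 1 : ℕ) : ℤ)) / (L : ℤ)) (γ i / (L : ℤ))) with hNB
  have hDm : ∀ (κ : Fin (d + 1)) (s : Site (d + 1)), Summable fun m : Site (d + 1) => D κ (translate Tc' s m) :=
    fun κ s => (hD κ).comp_injective (translate_injective hTc' s)
  rw [dper_apply]
  have hpt : ∀ m : Site (d + 1),
      (c * ∑ κ : Fin (d + 1), ∑' s : Site (d + 1), D κ s * 𝓋 k κ s (a, translate Tc γ m) (a', translate Tc γ' m))
        = c * ∑ κ : Fin (d + 1), ∑ s ∈ NB, D κ (translate Tc' s m) * 𝓋 k κ s (a, γ) (a', γ') :=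
    fun m => weightedCore_translate_eq_sum Tc Tc' h𝓋l h𝓋sh hL hT c D k m γ γ' a a'
  simp_rw [hpt]
  rw [tsum_mul_left, Summable.tsum_finsetSum fun κ _ => summable_sum fun s _ => (hDm κ s).mul_right _]
  congr 1
  refine Finset.sum_congr rfl fun κ _ => ?_
  rw [Summable.tsum_finsetSum fun s _ => (hDm κ s).mul_right _,
    tsum_eq_sum (s := NB) fun s hs => by rw [h𝓋l k κ s (a, γ) (a', γ') (fun h => hs (slot_mem_nearBox_of_near hL h)), mul_zero]]
  exact Finset.sum_congr rfl fun s _ => tsum_mul_right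

end Generic

/-! ## §2 The periodised weight is periodic; the slot sum folds onto representatives -/

section Reps

variable {𝓋 : ℕ → Fin (d + 1) → Site (d + 1) → Bond (d + 1) → Bond (d + 1) → ℝ} {L : ℕ}
  (Tc Tc' : Fin (d + 1) → ℕ)

omit Tc in
/-- [folklore] **the periodised weight is `Tc′`-periodic** (`translate_translate`, re-index `m ↦ n + m`; no convergence needed). -/
theorem periodisedWeight_translate (D : Site (d + 1) → ℝ) (s n : Site (d + 1)) :
    (∑' m : Site (d + 1), D (translate Tc' (translate Tc' s n) m)) = ∑' m : Site (d + 1), D (translate Tc' s m) := by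
  simp only [translate_translate]
  exact (Equiv.addLeft n).tsum_eq fun m => D (translate Tc' s m)

variable (h𝓋l : ∀ i μ y g g', ¬ Near L y g.2 → 𝓋 i μ y g g' = 0)
  (h𝓋sh : ∀ i μ y t g g', 𝓋 i μ (y + t) (g.sh ((L : ℤ) • t)) (g'.sh ((L : ℤ) • t)) = 𝓋 i μ y g g')
include h𝓋sh

/-- [folklore] **the brick at the translated slot, summed over the translates, IS the diagonal periodisation of the brick at the representative slot**:
`Σ'_n 𝓋 k κ (r + Tc′∘n) (a,γ) (a',γ') = dper Tc (𝓋 k κ r)♭ γ γ' a a'`, `(𝓋 k κ r)♭ x x' b b' := 𝓋 k κ r (b,x) (b',x')` (covariance; re-index `n ↦ −n`). -/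
theorem tsum_brick_translate_eq_dper (hT : ∀ i, Tc i = L * Tc' i) (k : ℕ) (κ : Fin (d + 1)) (r γ γ' : Site (d + 1)) (a a' : Fin (d + 1)) :
    (∑' n : Site (d + 1), 𝓋 k κ (translate Tc' r n) (a, γ) (a', γ'))
      = dper Tc (fun x x' (b b' : Fin (d + 1)) => 𝓋 k κ r (b, x) (b', x')) γ γ' a a' := by
  rw [dper_apply, ← (Equiv.neg (Site (d + 1))).tsum_eq fun n => 𝓋 k κ r (a, translate Tc γ n) (a', translate Tc γ' n)]
  refine tsum_congr fun n => ?_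
  rw [Equiv.neg_apply]
  -- `𝓋 k κ (r + t) (a,γ) (a',γ') = 𝓋 k κ r (a, γ − L•t) (a', γ' − L•t)`, `t = Tc′∘n`, and `γ − L•t = γ + Tc∘(−n)`
  set t : Site (d + 1) := fun i => (Tc' i : ℤ) * n i with ht
  have e1 : translate Tc' r n = r + t := translate_eq_add Tc' r n
  have e2 : ∀ (b : Fin (d + 1)) (x : Site (d + 1)), ((b, x) : Bond (d + 1)) = Bond.sh (b, translate Tc x (-n)) ((L : ℤ) • t) := fun b x => by
    rw [bond_translate_eq_sh Tc Tc' hT b x (-n)]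
    unfold Bond.sh
    refine Prod.ext rfl ?_
    show x = x + ((L : ℤ) • fun i => (Tc' i : ℤ) * (-n) i) + (L : ℤ) • t
    rw [ht, add_assoc, ← smul_add]
    conv_lhs => rw [← add_zero x]
    congr 1
    rw [← smul_zero (L : ℤ)]
    congr 1
    funext i
    simp only [Pi.add_apply, Pi.neg_apply, Pi.zero_apply]
    ring
  rw [e1, e2 a γ, e2 a' γ', h𝓋sh k κ r t]

include h𝓋l

/-- [folklore] **`dper_weightedCore_apply_reps` — PERIODISED WEIGHT TIMES PERIODISED BRICK, SUMMED OVER THE SLOT TORUS**: under the hypotheses of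
`dper_weightedCore_apply` and `NeZero (Tc′ i)`,
`dper Tc 𝒢[D] γ γ' a a' = c · Σ_κ Σ_{r ∈ pbox Tc′} (Σ'_m D κ (r + Tc′∘m)) · dper Tc (𝓋 k κ r)♭ γ γ' a a'` (`tsum_sites_eq_sum_tsum` on the finitely supported slot sum,
periodicity of the periodised weight, `tsum_brick_translate_eq_dper`). -/
theorem dper_weightedCore_apply_reps [∀ i, NeZero (Tc' i)] (hL : 0 < L) (hT : ∀ i, Tc i = L * Tc' i) (c : ℝ)
    {D : Fin (d + 1) → Site (d + 1) → ℝ} (hD : ∀ κ, Summable (D κ)) (k : ℕ) (γ γ' : Site (d + 1)) (a a' : Fin (d + 1)) :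
    dper Tc (fun x x' (b b' : Fin (d + 1)) => c * ∑ κ : Fin (d + 1), ∑' s : Site (d + 1), D κ s * 𝓋 k κ s (b, x) (b', x')) γ γ' a a'
      = c * ∑ κ : Fin (d + 1), ∑ r : ↥(pbox Tc'),
          (∑' m : Site (d + 1), D κ (translate Tc' (r : Site (d + 1)) m))
            * dper Tc (fun x x' (b b' : Fin (d + 1)) => 𝓋 k κ (r : Site (d + 1)) (b, x) (b', x')) γ γ' a a' := by
  have hTc' : ∀ i, 1 ≤ Tc' i := fun i => one_le_of_neZero (Tc' i)
  rw [dper_weightedCore_apply Tc Tc' h𝓋l h𝓋sh hL hT hTc' c hD k γ γ' a a']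
  congr 1
  refine Finset.sum_congr rfl fun κ _ => ?_
  -- the slot sum is finitely supported (near-box of `γ`), hence summable; fold it onto representatives
  have hG : Summable fun s : Site (d + 1) => (∑' m : Site (d + 1), D κ (translate Tc' s m)) * 𝓋 k κ s (a, γ) (a', γ') :=
    summable_of_ne_finset_zero (s := Fintype.piFinset (fun i => Finset.Icc ((γ i - ((2 * L - 1 : ℕ) : ℤ)) / (L : ℤ)) (γ i / (L : ℤ))))
      fun s hs => by rw [h𝓋l k κ s (a, γ) (a', γ') (fun h => hs (slot_mem_nearBox_of_near hL h)), mul_zero]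
  rw [tsum_sites_eq_sum_tsum (M := Tc') hG]
  refine Finset.sum_congr rfl fun r _ => ?_
  simp_rw [periodisedWeight_translate Tc' (D κ)]
  rw [tsum_mul_left, tsum_brick_translate_eq_dper Tc Tc' h𝓋sh hT k κ (r : Site (d + 1)) γ γ' a a']

end Reps

/-! ## §3 At the record: the storey cores of `cΛ · ℒN|ff`, periodised -/

section Record

variable {Lc : ℕ} [NeZero Lc] (R : Roots Lc) (P : Pins) (j : ℕ) (Tc Tc' : Fin (3 + 1) → ℕ)

/-- [folklore] **`lamR_top` — AT THE TOP STOREY THE TRANSPORTED MULTIPLIER RESPONSE IS `Λ′_N` ITSELF** (no transport: `compLinKer … 0` is the bond delta,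
an2 g60 `compLinKer_zero`): `λ′ᴿ_j (κ,s) = Λ′_N (κ,s) = Σ_{κ′} Σ'_u (AN R j) u (L•y) (inl κ′) (inr μ)·lamCoeffOf (KInv L) L κ s κ′ u` — the junction at the top storey is
(K1) for the nested column and nothing else. -/
theorem lamR_top (μ κ : Fin (3 + 1)) (y s : Site (3 + 1)) :
    (∑ ν : Fin (3 + 1), ∑' w : Site (3 + 1),
        (∑ κ' : Fin (3 + 1), ∑' u : Site (3 + 1),
            AN R j u (((Lc ^ (j + 1) : ℕ) : ℤ) • y) (Sum.inl κ') (Sum.inr μ) * lamCoeffOf (KInv (N := Lc ^ (j + 1)) (d := 3)) (Lc ^ (j + 1)) ν w κ' u)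
          * compLinKer (fun _ => symLinKerAt (toSite R.r) Lc) Lc 0 (κ, s) (ν, w))
      = ∑ κ' : Fin (3 + 1), ∑' u : Site (3 + 1),
          AN R j u (((Lc ^ (j + 1) : ℕ) : ℤ) • y) (Sum.inl κ') (Sum.inr μ) * lamCoeffOf (KInv (N := Lc ^ (j + 1)) (d := 3)) (Lc ^ (j + 1)) κ s κ' u := by
  rw [Finset.sum_eq_single_of_mem κ (Finset.mem_univ κ) (fun ν _ hν => ?_)]
  · rw [tsum_eq_single s (fun w hw => ?_)]
    · rw [compLinKer_zero, if_pos rfl, mul_one]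
    · rw [compLinKer_zero, if_neg (fun h => hw (Prod.mk.inj h).2), mul_zero]
  · exact (tsum_congr fun w => by rw [compLinKer_zero, if_neg (fun h => hν (Prod.mk.inj h).1), mul_zero]).trans tsum_zero

/-- [folklore] **`summable_lamCoreR_diag` — THE RECORD CORE's DIAGONAL LETTER** on any storey torus `Tc i = Lc · Tc′ i`, `1 ≤ Tc′ i`
(`summable_weightedCore_diag` at `symHessKerAt (toSite R.r) Lc`, weight `λ′ᴿ_k` by PART 15 `summable_lamR`). -/
theorem summable_lamCoreR_diag (hT : ∀ i, Tc i = Lc * Tc' i) (hTc' : ∀ i, 1 ≤ Tc' i) (k : ℕ) (μ : Fin (3 + 1)) (y γ γ' : Site (3 + 1))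
    (a a' : Fin (3 + 1)) :
    Summable fun m : Site (3 + 1) =>
      -(P.cΛ (j + 1)) * ∑ κ : Fin (3 + 1), ∑' s : Site (3 + 1),
        (∑ ν : Fin (3 + 1), ∑' w : Site (3 + 1),
            (∑ κ' : Fin (3 + 1), ∑' u : Site (3 + 1),
                AN R j u (((Lc ^ (j + 1) : ℕ) : ℤ) • y) (Sum.inl κ') (Sum.inr μ) * lamCoeffOf (KInv (N := Lc ^ (j + 1)) (d := 3)) (Lc ^ (j + 1)) ν w κ' u)
              * compLinKer (fun _ => symLinKerAt (toSite R.r) Lc) Lc (j - k) (κ, s) (ν, w))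
          * symHessKerAt (toSite R.r) Lc κ s (a, translate Tc γ m) (a', translate Tc γ' m) :=
  summable_weightedCore_diag (𝓋 := fun _ => symHessKerAt (toSite R.r) Lc) Tc Tc' (fun _ _ _ _ g' h => symHessKerAt_eq_zero_left R.hr h g')
    (fun _ μ' y' t g g' => symHessKerAt_add (toSite R.r) Lc μ' y' t g g') (Nat.pos_of_ne_zero (NeZero.ne Lc)) hT hTc' _
    (summable_lamR R j μ · y (j - k)) k γ γ' a a'

/-- [folklore] **`dper_lamCoreR_apply` — THE RECORD STOREY CORE, PERIODISED: THE TRANSPORTED MULTIPLIER RESPONSE GETS PERIODISED OVER THE SLOT TORUS**: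
`dper Tc 𝒢ᴿ_k γ γ' a a' = −cΛ · Σ_κ Σ'_s (Σ'_m λ′ᴿ_k (κ, s + Tc′∘m)) · symHessKerAt (toSite R.r) Lc κ s (a,γ) (a',γ')` (any storey torus `Tc i = Lc · Tc′ i`, `1 ≤ Tc′ i`). -/
theorem dper_lamCoreR_apply (hT : ∀ i, Tc i = Lc * Tc' i) (hTc' : ∀ i, 1 ≤ Tc' i) (k : ℕ) (μ : Fin (3 + 1)) (y γ γ' : Site (3 + 1))
    (a a' : Fin (3 + 1)) :
    dper Tc (fun x x' (b b' : Fin (3 + 1)) => -(P.cΛ (j + 1)) * ∑ κ : Fin (3 + 1), ∑' s : Site (3 + 1),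
        (∑ ν : Fin (3 + 1), ∑' w : Site (3 + 1),
            (∑ κ' : Fin (3 + 1), ∑' u : Site (3 + 1),
                AN R j u (((Lc ^ (j + 1) : ℕ) : ℤ) • y) (Sum.inl κ') (Sum.inr μ) * lamCoeffOf (KInv (N := Lc ^ (j + 1)) (d := 3)) (Lc ^ (j + 1)) ν w κ' u)
              * compLinKer (fun _ => symLinKerAt (toSite R.r) Lc) Lc (j - k) (κ, s) (ν, w))
          * symHessKerAt (toSite R.r) Lc κ s (b, x) (b', x')) γ γ' a a'
      = -(P.cΛ (j + 1)) * ∑ κ : Fin (3 + 1), ∑' s : Site (3 + 1),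
          (∑' m : Site (3 + 1), ∑ ν : Fin (3 + 1), ∑' w : Site (3 + 1),
              (∑ κ' : Fin (3 + 1), ∑' u : Site (3 + 1),
                  AN R j u (((Lc ^ (j + 1) : ℕ) : ℤ) • y) (Sum.inl κ') (Sum.inr μ) * lamCoeffOf (KInv (N := Lc ^ (j + 1)) (d := 3)) (Lc ^ (j + 1)) ν w κ' u)
                * compLinKer (fun _ => symLinKerAt (toSite R.r) Lc) Lc (j - k) (κ, translate Tc' s m) (ν, w))
            * symHessKerAt (toSite R.r) Lc κ s (a, γ) (a', γ') :=
  dper_weightedCore_apply (𝓋 := fun _ => symHessKerAt (toSite R.r) Lc) Tc Tc' (fun _ _ _ _ g' h => symHessKerAt_eq_zero_left R.hr h g')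
    (fun _ μ' y' t g g' => symHessKerAt_add (toSite R.r) Lc μ' y' t g g') (Nat.pos_of_ne_zero (NeZero.ne Lc)) hT hTc' _
    (summable_lamR R j μ · y (j - k)) k γ γ' a a'

/-- [folklore] **`dper_lamCoreR_apply_reps` — THE SAME OVER THE SLOT TORUS's REPRESENTATIVES: PERIODISED WEIGHT TIMES PERIODISED BRICK** —
`dper Tc 𝒢ᴿ_k γ γ' a a' = −cΛ · Σ_κ Σ_{r ∈ pbox Tc′} (Σ'_m λ′ᴿ_k (κ, r + Tc′∘m)) · dper Tc (symHessKerAt (toSite R.r) Lc κ r)♭ γ γ' a a'` — the row's side of SPEC-49 §B's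
weight word: on the representatives the road's `w · hb` is to meet `cΛ · Σ'_m λ′ᴿ_k (κ, r + Tc′∘m)`. -/
theorem dper_lamCoreR_apply_reps [∀ i, NeZero (Tc' i)] (hT : ∀ i, Tc i = Lc * Tc' i) (k : ℕ) (μ : Fin (3 + 1)) (y γ γ' : Site (3 + 1))
    (a a' : Fin (3 + 1)) :
    dper Tc (fun x x' (b b' : Fin (3 + 1)) => -(P.cΛ (j + 1)) * ∑ κ : Fin (3 + 1), ∑' s : Site (3 + 1),
        (∑ ν : Fin (3 + 1), ∑' w : Site (3 + 1),
            (∑ κ' : Fin (3 + 1), ∑' u : Site (3 + 1),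
                AN R j u (((Lc ^ (j + 1) : ℕ) : ℤ) • y) (Sum.inl κ') (Sum.inr μ) * lamCoeffOf (KInv (N := Lc ^ (j + 1)) (d := 3)) (Lc ^ (j + 1)) ν w κ' u)
              * compLinKer (fun _ => symLinKerAt (toSite R.r) Lc) Lc (j - k) (κ, s) (ν, w))
          * symHessKerAt (toSite R.r) Lc κ s (b, x) (b', x')) γ γ' a a'
      = -(P.cΛ (j + 1)) * ∑ κ : Fin (3 + 1), ∑ r : ↥(pbox Tc'),
          (∑' m : Site (3 + 1), ∑ ν : Fin (3 + 1), ∑' w : Site (3 + 1),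
              (∑ κ' : Fin (3 + 1), ∑' u : Site (3 + 1),
                  AN R j u (((Lc ^ (j + 1) : ℕ) : ℤ) • y) (Sum.inl κ') (Sum.inr μ) * lamCoeffOf (KInv (N := Lc ^ (j + 1)) (d := 3)) (Lc ^ (j + 1)) ν w κ' u)
                * compLinKer (fun _ => symLinKerAt (toSite R.r) Lc) Lc (j - k) (κ, translate Tc' (r : Site (3 + 1)) m) (ν, w))
            * dper Tc (fun x x' (b b' : Fin (3 + 1)) => symHessKerAt (toSite R.r) Lc κ (r : Site (3 + 1)) (b, x) (b', x')) γ γ' a a' :=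
  dper_weightedCore_apply_reps (𝓋 := fun _ => symHessKerAt (toSite R.r) Lc) Tc Tc' (fun _ _ _ _ g' h => symHessKerAt_eq_zero_left R.hr h g')
    (fun _ μ' y' t g g' => symHessKerAt_add (toSite R.r) Lc μ' y' t g g') (Nat.pos_of_ne_zero (NeZero.ne Lc)) hT _
    (summable_lamR R j μ · y (j - k)) k γ γ' a a'

omit [NeZero Lc] in
/-- [folklore] the wrapper's tower tori one level apart differ by the blocking: `towerTorus Lc (fine Lc M) m i = Lc · towerTorus Lc M m i` (`towerTorus_apply`). -/
theorem towerTorus_fine_apply_eq (M : Fin (3 + 1) → ℕ) (m : ℕ) (i : Fin (3 + 1)) :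
    towerTorus Lc (fine Lc M) m i = Lc * towerTorus Lc M m i := by
  rw [towerTorus_apply, towerTorus_apply]
  show Lc ^ m * (Lc * M i) = Lc * (Lc ^ m * M i)
  ring

/-- [folklore] **`dper_lamCoreR_apply_tower` — AT THE WRAPPER's TOWER**: the storey torus `towerTorus Lc (fine Lc M) m` over the slot torus `towerTorus Lc M m`
(the road's core at co-depth `j'` lives on `towerTorus Lc (fine Lc (Mc B)) j'`):
`dper (towerTorus Lc (fine Lc M) m) 𝒢ᴿ_k γ γ' a a' = −cΛ · Σ_κ Σ_{r ∈ pbox (towerTorus Lc M m)} (Σ'_{m'} λ′ᴿ_k (κ, r + (towerTorus Lc M m)∘m')) · dper (towerTorus Lc (fine Lc M) m) (𝒽 κ r)♭ γ γ' a a'`. -/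
theorem dper_lamCoreR_apply_tower (M : Fin (3 + 1) → ℕ) [∀ i, NeZero (M i)] (m k : ℕ) (μ : Fin (3 + 1)) (y γ γ' : Site (3 + 1))
    (a a' : Fin (3 + 1)) :
    dper (towerTorus Lc (fine Lc M) m) (fun x x' (b b' : Fin (3 + 1)) => -(P.cΛ (j + 1)) * ∑ κ : Fin (3 + 1), ∑' s : Site (3 + 1),
        (∑ ν : Fin (3 + 1), ∑' w : Site (3 + 1),
            (∑ κ' : Fin (3 + 1), ∑' u : Site (3 + 1),
                AN R j u (((Lc ^ (j + 1) : ℕ) : ℤ) • y) (Sum.inl κ') (Sum.inr μ) * lamCoeffOf (KInv (N := Lc ^ (j + 1)) (d := 3)) (Lc ^ (j + 1)) ν w κ' u)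
              * compLinKer (fun _ => symLinKerAt (toSite R.r) Lc) Lc (j - k) (κ, s) (ν, w))
          * symHessKerAt (toSite R.r) Lc κ s (b, x) (b', x')) γ γ' a a'
      = -(P.cΛ (j + 1)) * ∑ κ : Fin (3 + 1), ∑ r : ↥(pbox (towerTorus Lc M m)),
          (∑' m' : Site (3 + 1), ∑ ν : Fin (3 + 1), ∑' w : Site (3 + 1),
              (∑ κ' : Fin (3 + 1), ∑' u : Site (3 + 1),
                  AN R j u (((Lc ^ (j + 1) : ℕ) : ℤ) • y) (Sum.inl κ') (Sum.inr μ) * lamCoeffOf (KInv (N := Lc ^ (j + 1)) (d := 3)) (Lc ^ (j + 1)) ν w κ' u)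
                * compLinKer (fun _ => symLinKerAt (toSite R.r) Lc) Lc (j - k) (κ, translate (towerTorus Lc M m) (r : Site (3 + 1)) m') (ν, w))
            * dper (towerTorus Lc (fine Lc M) m) (fun x x' (b b' : Fin (3 + 1)) => symHessKerAt (toSite R.r) Lc κ (r : Site (3 + 1)) (b, x) (b', x'))
                γ γ' a a' :=
  dper_lamCoreR_apply_reps R P j (towerTorus Lc (fine Lc M) m) (towerTorus Lc M m) (towerTorus_fine_apply_eq M m) k μ y γ γ' a a'

end Record

/-! ## §4 The road's `ΛN` and the row's lattice Λ sector have the SAME diagonal periodisation -/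

section LamN

variable {Lc : ℕ} [NeZero Lc] (R : Roots Lc) (j : ℕ) (T : Fin (3 + 1) → ℕ) [∀ i, NeZero (T i)]

/-- [folklore] **`dper_lamN_eq_dper_LN` — THE ROAD's Λ CORE `ΛN` (torus-column-weighted box sum, `TorusLamJunctionShape` §2) AND THE ROW's LATTICE Λ SECTOR
`ℒN μ y|ff` HAVE THE SAME DIAGONAL PERIODISATION** on every box `T` with `Lc^(j+1) ∣ T i`:
`dper T (fun x z a b => c · Σ_{b₀ ∈ pbox T × Fin 4} (perF T (AN R j)) ((b₀.1, inl b₀.2), (wrapPt T (L•y), inr μ)) · S^Λ b₀.2 b₀.1 x z (inl a) (inl b)) x z a b = c · dper T (ℒN μ y) x z (inl a) (inl b)`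
(an2 g42 `CombHId1Letters.dper_vertexOfK_eq_sum` at the N-chart with PART 11's letters + `perZ_coarse_col_eq_perF`; the finite box sum exchanged with the period sum by `summable_dper`)
— so the right side of the road's `hΛN` is `cΛ (j+1) ·` the diagonal periodisation of PART 15's `Σ_k 𝒦ᴿ_k ∕ cΛ (j+1)`. -/
theorem dper_lamN_eq_dper_LN (hT : ∀ i, Lc ^ (j + 1) ∣ T i) (c : ℝ) (μ : Fin (3 + 1)) (y x z : Site (3 + 1)) (a b : Fin (3 + 1)) :
    dper T (fun x' z' (a' b' : Fin (3 + 1)) => c * ∑ b₀ : ↥(pbox T) × Fin (3 + 1),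
        perF T (AN R j) (b₀.1, Sum.inl b₀.2) (wrapPt T (((Lc ^ (j + 1) : ℕ) : ℤ) • y), Sum.inr μ)
          * SLam (Lc ^ (j + 1)) (lamCoeffOf (KInv (N := Lc ^ (j + 1)) (d := 3)) (Lc ^ (j + 1))) (compH R.r Lc (j + 1)) b₀.2 (b₀.1 : Site (3 + 1))
              x' z' (Sum.inl a') (Sum.inl b')) x z a b
      = c * dper T (vertexOfK (AN R j) (Lc ^ (j + 1))
          (SLam (Lc ^ (j + 1)) (lamCoeffOf (KInv (N := Lc ^ (j + 1)) (d := 3)) (Lc ^ (j + 1))) (compH R.r Lc (j + 1))) μ y) x z (Sum.inl a) (Sum.inl b) := by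
  obtain ⟨δK, CK, hδK, hCK, hK⟩ := decays_AN R j
  have hKinv := AN_translate_invariant R j T hT
  have hSt' := periodCov_of_St T (lamSector_St R j) hT
  obtain ⟨Cs, δs, hδs, hS⟩ := locStencil_lamSector R j
  have hCs : 0 ≤ Cs := (hS 0 0).nonneg (Sum.inl 0)
  have hsum : ∀ b₀ : ↥(pbox T) × Fin (3 + 1), Summable fun m : Site (3 + 1) =>
      SLam (Lc ^ (j + 1)) (lamCoeffOf (KInv (N := Lc ^ (j + 1)) (d := 3)) (Lc ^ (j + 1))) (compH R.r Lc (j + 1)) b₀.2 (b₀.1 : Site (3 + 1))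
        (translate T x m) (translate T z m) (Sum.inl a) (Sum.inl b) := fun b₀ => summable_dper T (hS b₀.2 (b₀.1 : Site (3 + 1))) hCs hδs x z _ _
  rw [dper_vertexOfK_eq_sum T hKinv hK hCK hδK hSt' hS hCs hδs μ y x z (Sum.inl a) (Sum.inl b), dper_apply, tsum_mul_left]
  congr 1
  rw [Summable.tsum_finsetSum (fun b₀ _ => (hsum b₀).mul_left _), Fintype.sum_prod_type]
  refine Finset.sum_congr rfl fun u _ => Finset.sum_congr rfl fun κ' _ => ?_
  rw [tsum_mul_left, perZ_coarse_col_eq_perF T, dper_apply]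

end LamN

end Summit.QuantumFields.BalabanUV.Beta.NVertexLamCorePeriodised

end
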